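import Summits.CriticalPhenomena.PercolationContinuityZ3.Theorems.PercNearOneGluingNoHeavyLowerTailSahiCombHybridKernelThree
import Summits.CriticalPhenomena.PercolationContinuityZ3.Theorems.PercNearOneGluingNoHeavyLowerTailSahiCombTriangleSections

/-!
# The comb hierarchy for Sahi's `E_k`: the CLASS-T BRIDGE — on the triangle class the (M⁺⁺-3) coefficient `hybCoeff` IS the
# three-function triangle functional `TRI`

Support file of the one-cut programme (crux `NoHeavyLowerTail`, stmt-CriticalPhenomena-4575; cell `prim-masterthm`, seat P5 gen 8;
report `P5-LORENTZIAN-TEST.md` §10.3 (the triangle class), §11.1–11.3, §13).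

A triple of events `U_0, U_1, U_2 ⊆ 2^ι` with declared supports `E_0, E_1, E_2` is of CLASS T when no coordinate is declared by all
three (`SahiHybrid.IsClassT`).  Fix a reduced profile `s` (tree `SahiHybrid.redProfile`).  In the fibre of `s` every coordinate is
either FROZEN (open in every interested copy, `frozenOpen`, or closed in all of them) or FREE: declared by exactly two members `i < j`
with `s_e = 1`, so that exactly one of the two interested copies is open there (`freePair E s i j`).  Writing `x ⊆ freePair 0 1`,
`y ⊆ freePair 0 2`, `z ⊆ freePair 1 2` for the open sets of copies `1`, `2`, `2` on the three free blocks, the fibre is parametrised by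
`triParam E s x y z = (copy 0, copy 1, copy 2) = (O_0 ∪ x̄ ∪ ȳ, O_1 ∪ x ∪ z̄, O_2 ∪ y ∪ z)` (bars = complements inside the blocks), and
with the SECTIONS `f(x,y) = 1_{U_0}(O_0 ∪ x ∪ y)`, `g(x,z) = 1_{U_1}(O_1 ∪ x ∪ z)`, `h(y,z) = 1_{U_2}(O_2 ∪ y ∪ z)` (`secF/secG/secH`):

* **`SahiHybrid.kernel_triParam`** — the hybrid kernel on the fibre is the TRI integrand POINTWISE:
  `kernel E U (triParam x y z) = h(y,z)·[2f(x,y)g(x,z) − f(x̄,ȳ)g(x,z) − f(x̄,y)g(x,z̄) − f(x,ȳ)g(x,z̄) + f(x̄,ȳ)g(x,z̄)]` (`triTerm`),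
  by `kernel_three` and the hybrid formulas: in block `B` member `0` sees `x` iff `1 ∈ B` (else `x̄`) and `y` iff `2 ∈ B` (else `ȳ`),
  member `1` sees `x` and (`z` iff `2 ∈ B`), member `2` sees `(y,z)`;
* `SahiHybrid.triParam_mem_fibre`, `eq_triParam_of_mem_fibre` — `triParam` is a bijection from the triples of subsets of the free
  blocks onto the fibre `{ξ ∈ truncSpace E | redProfile E ξ = s}` (for `s` in the box of the minimal multidegree);
* **`SahiHybrid.hybCoeff_eq_tri`** — THE BRIDGE (report §10.3, there verified numerically):
  `hybCoeff E U s = Σ_{x ⊆ freePair 0 1} Σ_{y ⊆ freePair 0 2} Σ_{z ⊆ freePair 1 2} triTerm E s U x y z = TRI(f,g,h)`.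
So (M⁺⁺-3) on the triangle class ⟺ `TRI ≥ 0` for all block sizes; the thin-edge cells (`#(freePair 0 1) ≤ 1`) are closed in
`…SahiCombTriangleThinEdge` via the five-up-set inequality.  Everything here is proved; axioms standard.
HONEST LABEL: an identity (reparametrisation of a finite sum); (M⁺⁺-3)/`C_3` stay OPEN. [this work]
-/

noncomputable section

open scoped Classical

namespace Summit.CriticalPhenomena.PercolationContinuityZ3.Theorems

open Finset Function
open Literature.Combinatorics.Sahi2008
open Literature.Probability.Percolation (DeterminedBy determinedBy_iff)
open Literature.Probability.Percolation.DecisionTree (ind ind_of_mem ind_of_not_mem ind_nonneg)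
open SahiComb

namespace SahiHybrid

variable {ι : Type}

/-! ### The kernel on the parametrised fibre: what each member sees in each block -/

section Kernel

variable {E : Fin 3 → Finset ι} {s : ι → ℕ} {U : Fin 3 → Set (Set ι)} {x y z : Set ι}
  (hT : IsClassT E) (hU : ∀ i, DeterminedBy (U i) ↑(E i))
  (hx : x ⊆ freePair E s 0 1) (hy : y ⊆ freePair E s 0 2) (hz : z ⊆ freePair E s 1 2)

include hT hx hy hz in
/-- The pointwise facts at a coordinate used in every case analysis below. [this work] -/
theorem coord_facts (e : ι) :
    ¬ (e ∈ E 0 ∧ e ∈ E 1 ∧ e ∈ E 2) ∧ (e ∈ x → e ∈ E 0 ∧ e ∈ E 1 ∧ s e = 1) ∧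
      (e ∈ y → e ∈ E 0 ∧ e ∈ E 2 ∧ s e = 1) ∧ (e ∈ z → e ∈ E 1 ∧ e ∈ E 2 ∧ s e = 1) :=
  ⟨hT e, fun h => hx h, fun h => hy h, fun h => hz h⟩

/-- Alone, member `0` sees `(x̄, ȳ)`. [this work] -/
theorem ind_zero_single (hU : ∀ i, DeterminedBy (U i) ↑(E i)) :
    ind (U 0) (hybrid E {0} (triParam E s x y z)) = secF E s U (freePair E s 0 1 \ x) (freePair E s 0 2 \ y) := by
  unfold secF
  rw [hybrid_singleton]
  exact ind_eq_of_agree (hU 0) fun e he0 => ⟨fun h => h.1, fun h => ⟨h, he0⟩⟩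

/-- Alone, member `1` sees `(x, z̄)`. [this work] -/
theorem ind_one_single (hU : ∀ i, DeterminedBy (U i) ↑(E i)) :
    ind (U 1) (hybrid E {1} (triParam E s x y z)) = secG E s U x (freePair E s 1 2 \ z) := by
  unfold secG
  rw [hybrid_singleton]
  exact ind_eq_of_agree (hU 1) fun e he1 => ⟨fun h => h.1, fun h => ⟨h, he1⟩⟩

/-- Alone, member `2` sees `(y, z)`. [this work] -/
theorem ind_two_single (hU : ∀ i, DeterminedBy (U i) ↑(E i)) :
    ind (U 2) (hybrid E {2} (triParam E s x y z)) = secH E s U y z := by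
  unfold secH
  rw [hybrid_singleton]
  exact ind_eq_of_agree (hU 2) fun e he2 => ⟨fun h => h.1, fun h => ⟨h, he2⟩⟩

include hT hU hx hy hz

/-- In block `{0,1}` member `0` sees `(x, ȳ)`. [this work] -/
theorem ind_zero_pair01 :
    ind (U 0) (hybrid E {0, 1} (triParam E s x y z)) = secF E s U x (freePair E s 0 2 \ y) := by
  unfold secF
  rw [hybrid_pair E (show (0 : Fin 3) < 1 by decide)]
  refine ind_eq_of_agree (hU 0) fun e he0 => ?_
  obtain ⟨hTe, hxe, hye, hze⟩ := coord_facts hT hx hy hz e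
  have hc := card_slot_three E e
  simp only [triParam_zero, triParam_one, frozenOpen, freePair, Set.mem_union, Set.mem_inter_iff, Set.mem_sdiff,
    Set.mem_setOf_eq, mem_coe, he0, true_and] at hxe hye hze ⊢
  by_cases he1 : e ∈ E 1 <;> by_cases he2 : e ∈ E 2 <;> by_cases hex : e ∈ x <;> by_cases hey : e ∈ y <;>
    by_cases hez : e ∈ z <;> simp_all

/-- In block `{0,1}` member `1` sees `(x, z̄)`. [this work] -/
theorem ind_one_pair01 :
    ind (U 1) (hybrid E {0, 1} (triParam E s x y z)) = secG E s U x (freePair E s 1 2 \ z) := by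
  unfold secG
  rw [hybrid_pair E (show (0 : Fin 3) < 1 by decide)]
  refine ind_eq_of_agree (hU 1) fun e he1 => ?_
  obtain ⟨hTe, hxe, hye, hze⟩ := coord_facts hT hx hy hz e
  have hc := card_slot_three E e
  simp only [triParam_zero, triParam_one, frozenOpen, freePair, Set.mem_union, Set.mem_inter_iff, Set.mem_sdiff,
    Set.mem_setOf_eq, mem_coe, he1, true_and, and_true] at hxe hye hze ⊢
  by_cases he0 : e ∈ E 0 <;> by_cases he2 : e ∈ E 2 <;> by_cases hex : e ∈ x <;> by_cases hey : e ∈ y <;>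
    by_cases hez : e ∈ z <;> simp_all

/-- In block `{0,2}` member `0` sees `(x̄, y)`. [this work] -/
theorem ind_zero_pair02 :
    ind (U 0) (hybrid E {0, 2} (triParam E s x y z)) = secF E s U (freePair E s 0 1 \ x) y := by
  unfold secF
  rw [hybrid_pair E (show (0 : Fin 3) < 2 by decide)]
  refine ind_eq_of_agree (hU 0) fun e he0 => ?_
  obtain ⟨hTe, hxe, hye, hze⟩ := coord_facts hT hx hy hz e
  have hc := card_slot_three E e
  simp only [triParam_zero, triParam_two, frozenOpen, freePair, Set.mem_union, Set.mem_inter_iff, Set.mem_sdiff,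
    Set.mem_setOf_eq, mem_coe, he0, true_and] at hxe hye hze ⊢
  by_cases he1 : e ∈ E 1 <;> by_cases he2 : e ∈ E 2 <;> by_cases hex : e ∈ x <;> by_cases hey : e ∈ y <;>
    by_cases hez : e ∈ z <;> simp_all

/-- In block `{0,2}` member `2` sees `(y, z)`. [this work] -/
theorem ind_two_pair02 :
    ind (U 2) (hybrid E {0, 2} (triParam E s x y z)) = secH E s U y z := by
  unfold secH
  rw [hybrid_pair E (show (0 : Fin 3) < 2 by decide)]
  refine ind_eq_of_agree (hU 2) fun e he2 => ?_
  obtain ⟨hTe, hxe, hye, hze⟩ := coord_facts hT hx hy hz e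
  have hc := card_slot_three E e
  simp only [triParam_zero, triParam_two, frozenOpen, freePair, Set.mem_union, Set.mem_inter_iff, Set.mem_sdiff,
    Set.mem_setOf_eq, mem_coe, he2, true_and, and_true] at hxe hye hze ⊢
  by_cases he0 : e ∈ E 0 <;> by_cases he1 : e ∈ E 1 <;> by_cases hex : e ∈ x <;> by_cases hey : e ∈ y <;>
    by_cases hez : e ∈ z <;> simp_all

/-- In block `{1,2}` member `1` sees `(x, z)`. [this work] -/
theorem ind_one_pair12 :
    ind (U 1) (hybrid E {1, 2} (triParam E s x y z)) = secG E s U x z := by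
  unfold secG
  rw [hybrid_pair E (show (1 : Fin 3) < 2 by decide)]
  refine ind_eq_of_agree (hU 1) fun e he1 => ?_
  obtain ⟨hTe, hxe, hye, hze⟩ := coord_facts hT hx hy hz e
  have hc := card_slot_three E e
  simp only [triParam_one, triParam_two, frozenOpen, freePair, Set.mem_union, Set.mem_inter_iff, Set.mem_sdiff,
    Set.mem_setOf_eq, mem_coe, he1, true_and, and_true] at hxe hye hze ⊢
  by_cases he0 : e ∈ E 0 <;> by_cases he2 : e ∈ E 2 <;> by_cases hex : e ∈ x <;> by_cases hey : e ∈ y <;>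
    by_cases hez : e ∈ z <;> simp_all

/-- In block `{1,2}` member `2` sees `(y, z)`. [this work] -/
theorem ind_two_pair12 :
    ind (U 2) (hybrid E {1, 2} (triParam E s x y z)) = secH E s U y z := by
  unfold secH
  rw [hybrid_pair E (show (1 : Fin 3) < 2 by decide)]
  refine ind_eq_of_agree (hU 2) fun e he2 => ?_
  obtain ⟨hTe, hxe, hye, hze⟩ := coord_facts hT hx hy hz e
  have hc := card_slot_three E e
  simp only [triParam_one, triParam_two, frozenOpen, freePair, Set.mem_union, Set.mem_inter_iff, Set.mem_sdiff,
    Set.mem_setOf_eq, mem_coe, he2, true_and, and_true] at hxe hye hze ⊢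
  by_cases he0 : e ∈ E 0 <;> by_cases he1 : e ∈ E 1 <;> by_cases hex : e ∈ x <;> by_cases hey : e ∈ y <;>
    by_cases hez : e ∈ z <;> simp_all

/-- In the full block member `0` sees `(x, y)`. [this work] -/
theorem ind_zero_univ :
    ind (U 0) (hybrid E univ (triParam E s x y z)) = secF E s U x y := by
  unfold secF
  rw [hybrid_univ_three]
  refine ind_eq_of_agree (hU 0) fun e he0 => ?_
  obtain ⟨hTe, hxe, hye, hze⟩ := coord_facts hT hx hy hz e
  have hc := card_slot_three E e
  simp only [triParam_zero, triParam_one, triParam_two, frozenOpen, freePair, Set.mem_union, Set.mem_inter_iff,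
    Set.mem_sdiff, Set.mem_setOf_eq, mem_coe, he0, true_and] at hxe hye hze ⊢
  by_cases he1 : e ∈ E 1 <;> by_cases he2 : e ∈ E 2 <;> by_cases hex : e ∈ x <;> by_cases hey : e ∈ y <;>
    by_cases hez : e ∈ z <;> simp_all

/-- In the full block member `1` sees `(x, z)`. [this work] -/
theorem ind_one_univ :
    ind (U 1) (hybrid E univ (triParam E s x y z)) = secG E s U x z := by
  unfold secG
  rw [hybrid_univ_three]
  refine ind_eq_of_agree (hU 1) fun e he1 => ?_
  obtain ⟨hTe, hxe, hye, hze⟩ := coord_facts hT hx hy hz e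
  have hc := card_slot_three E e
  simp only [triParam_zero, triParam_one, triParam_two, frozenOpen, freePair, Set.mem_union, Set.mem_inter_iff,
    Set.mem_sdiff, Set.mem_setOf_eq, mem_coe, he1, true_and, and_true] at hxe hye hze ⊢
  by_cases he0 : e ∈ E 0 <;> by_cases he2 : e ∈ E 2 <;> by_cases hex : e ∈ x <;> by_cases hey : e ∈ y <;>
    by_cases hez : e ∈ z <;> simp_all

/-- In the full block member `2` sees `(y, z)`. [this work] -/
theorem ind_two_univ :
    ind (U 2) (hybrid E univ (triParam E s x y z)) = secH E s U y z := by
  unfold secH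
  rw [hybrid_univ_three]
  refine ind_eq_of_agree (hU 2) fun e he2 => ?_
  obtain ⟨hTe, hxe, hye, hze⟩ := coord_facts hT hx hy hz e
  have hc := card_slot_three E e
  simp only [triParam_zero, triParam_one, triParam_two, frozenOpen, freePair, Set.mem_union, Set.mem_inter_iff,
    Set.mem_sdiff, Set.mem_setOf_eq, mem_coe, he2, true_and, and_true] at hxe hye hze ⊢
  by_cases he0 : e ∈ E 0 <;> by_cases he1 : e ∈ E 1 <;> by_cases hex : e ∈ x <;> by_cases hey : e ∈ y <;>
    by_cases hez : e ∈ z <;> simp_all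

/-- **The hybrid kernel on the parametrised fibre is the TRI integrand, pointwise.** [this work] -/
theorem kernel_triParam : kernel E U (triParam E s x y z) = triTerm E s U x y z := by
  rw [kernel_three]
  unfold blockFun
  rw [prod_singleton, prod_singleton, prod_singleton, prod_pair (by decide), prod_pair (by decide), prod_pair (by decide),
    Fin.prod_univ_three]
  rw [ind_zero_single hU, ind_one_single hU, ind_two_single hU,
    ind_zero_pair01 hT hU hx hy hz, ind_one_pair01 hT hU hx hy hz, ind_zero_pair02 hT hU hx hy hz,
    ind_two_pair02 hT hU hx hy hz, ind_one_pair12 hT hU hx hy hz, ind_two_pair12 hT hU hx hy hz,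
    ind_zero_univ hT hU hx hy hz, ind_one_univ hT hU hx hy hz, ind_two_univ hT hU hx hy hz]
  unfold triTerm
  ring

end Kernel

/-! ### The fibre of a profile is parametrised by the triples of subsets of the free blocks -/

section Fibre

variable {E : Fin 3 → Finset ι} {s : ι → ℕ} (hT : IsClassT E)

include hT

/-- The parametrisation lands in the truncated copy arrays. [this work] -/
theorem triParam_mem_truncSpace [Fintype ι] {x y z : Set ι} (hx : x ⊆ freePair E s 0 1) (hy : y ⊆ freePair E s 0 2)
    (hz : z ⊆ freePair E s 1 2) : triParam E s x y z ∈ truncSpace E := by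
  rw [mem_truncSpace]
  have h0 : triParam E s x y z 0 ⊆ ↑(E 0) := by
    intro e he
    obtain ⟨-, hxe, hye, -⟩ := coord_facts hT hx hy hz e
    simp only [triParam_zero, frozenOpen, freePair, Set.mem_union, Set.mem_sdiff, Set.mem_setOf_eq] at he
    rw [mem_coe]
    tauto
  have h1 : triParam E s x y z 1 ⊆ ↑(E 1) := by
    intro e he
    obtain ⟨-, hxe, -, hze⟩ := coord_facts hT hx hy hz e
    simp only [triParam_one, frozenOpen, freePair, Set.mem_union, Set.mem_sdiff, Set.mem_setOf_eq] at he
    rw [mem_coe]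
    tauto
  have h2 : triParam E s x y z 2 ⊆ ↑(E 2) := by
    intro e he
    obtain ⟨-, -, hye, hze⟩ := coord_facts hT hx hy hz e
    simp only [triParam_two, frozenOpen, Set.mem_union, Set.mem_setOf_eq] at he
    rw [mem_coe]
    tauto
  intro i
  fin_cases i
  · exact h0
  · exact h1
  · exact h2

/-- The parametrisation has reduced profile `s` (for `s` in the box of the minimal multidegree). [this work] -/
theorem redProfile_triParam [Fintype ι] (hs : s ∈ box (minDeg E)) {x y z : Set ι} (hx : x ⊆ freePair E s 0 1)
    (hy : y ⊆ freePair E s 0 2) (hz : z ⊆ freePair E s 1 2) : redProfile E (triParam E s x y z) = s := by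
  funext e
  rw [redProfile_three]
  obtain ⟨hTe, hxe, hye, hze⟩ := coord_facts hT hx hy hz e
  have hc := card_slot_three E e
  have hse : s e ≤ (slot E e).card := mem_box.1 hs e
  simp only [triParam_zero, triParam_one, triParam_two, frozenOpen, freePair, Set.mem_union, Set.mem_sdiff,
    Set.mem_setOf_eq] at hxe hye hze ⊢
  clear hs hx hy hz
  by_cases he0 : e ∈ E 0 <;> by_cases he1 : e ∈ E 1 <;> by_cases he2 : e ∈ E 2 <;> by_cases hs1 : s e = 1 <;>
    by_cases hs2 : s e = 2 <;> by_cases hex : e ∈ x <;> by_cases hey : e ∈ y <;> by_cases hez : e ∈ z <;>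
    simp_all <;> omega

omit hT in
/-- The free-block coordinates of the parametrisation recover `(x, y, z)`. [this work] -/
theorem triParam_inter_freePair {x y z : Set ι} (hx : x ⊆ freePair E s 0 1) (hy : y ⊆ freePair E s 0 2)
    (hz : z ⊆ freePair E s 1 2) (hT : IsClassT E) :
    triParam E s x y z 1 ∩ freePair E s 0 1 = x ∧ triParam E s x y z 2 ∩ freePair E s 0 2 = y ∧
      triParam E s x y z 2 ∩ freePair E s 1 2 = z := by
  refine ⟨?_, ?_, ?_⟩ <;> ext e <;> obtain ⟨hTe, hxe, hye, hze⟩ := coord_facts hT hx hy hz e <;>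
    have hc := card_slot_three E e <;>
    simp only [triParam_one, triParam_two, frozenOpen, freePair, Set.mem_union, Set.mem_inter_iff, Set.mem_sdiff,
      Set.mem_setOf_eq] at hxe hye hze ⊢ <;>
    by_cases he0 : e ∈ E 0 <;> by_cases he1 : e ∈ E 1 <;> by_cases he2 : e ∈ E 2 <;> by_cases hex : e ∈ x <;>
    by_cases hey : e ∈ y <;> by_cases hez : e ∈ z <;> simp_all

/-- Every copy array of the fibre is parametrised (by its free-block coordinates). [this work] -/
theorem eq_triParam_of_mem_fibre [Fintype ι] {ξ : Fin 3 → Set ι} (hξ : ξ ∈ truncSpace E) (hr : redProfile E ξ = s) :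
    triParam E s (ξ 1 ∩ freePair E s 0 1) (ξ 2 ∩ freePair E s 0 2) (ξ 2 ∩ freePair E s 1 2) = ξ := by
  have hsub := (mem_truncSpace E).1 hξ
  -- the local facts at a coordinate
  have key : ∀ e, ¬ (e ∈ E 0 ∧ e ∈ E 1 ∧ e ∈ E 2) ∧ (e ∈ ξ 0 → e ∈ E 0) ∧ (e ∈ ξ 1 → e ∈ E 1) ∧ (e ∈ ξ 2 → e ∈ E 2) ∧
      s e = (if e ∈ E 0 ∧ e ∈ ξ 0 then 1 else 0) + (if e ∈ E 1 ∧ e ∈ ξ 1 then 1 else 0) + (if e ∈ E 2 ∧ e ∈ ξ 2 then 1 else 0) ∧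
      (slot E e).card = (if e ∈ E 0 then 1 else 0) + (if e ∈ E 1 then 1 else 0) + (if e ∈ E 2 then 1 else 0) :=
    fun e => ⟨hT e, fun h => hsub 0 h, fun h => hsub 1 h, fun h => hsub 2 h, by rw [← redProfile_three, hr], card_slot_three E e⟩
  have e0 : triParam E s (ξ 1 ∩ freePair E s 0 1) (ξ 2 ∩ freePair E s 0 2) (ξ 2 ∩ freePair E s 1 2) 0 = ξ 0 := by
    ext e
    obtain ⟨hTe, h0e, h1e, h2e, hre, hc⟩ := key e
    simp only [triParam_zero, frozenOpen, freePair, Set.mem_union, Set.mem_inter_iff, Set.mem_sdiff, Set.mem_setOf_eq]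
    clear key hsub hξ hr hT
    by_cases he0 : e ∈ E 0 <;> by_cases he1 : e ∈ E 1 <;> by_cases he2 : e ∈ E 2 <;> by_cases hx0 : e ∈ ξ 0 <;>
      by_cases hx1 : e ∈ ξ 1 <;> by_cases hx2 : e ∈ ξ 2 <;> simp_all
  have e1 : triParam E s (ξ 1 ∩ freePair E s 0 1) (ξ 2 ∩ freePair E s 0 2) (ξ 2 ∩ freePair E s 1 2) 1 = ξ 1 := by
    ext e
    obtain ⟨hTe, h0e, h1e, h2e, hre, hc⟩ := key e
    simp only [triParam_one, frozenOpen, freePair, Set.mem_union, Set.mem_inter_iff, Set.mem_sdiff, Set.mem_setOf_eq]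
    clear key hsub hξ hr hT
    by_cases he0 : e ∈ E 0 <;> by_cases he1 : e ∈ E 1 <;> by_cases he2 : e ∈ E 2 <;> by_cases hx0 : e ∈ ξ 0 <;>
      by_cases hx1 : e ∈ ξ 1 <;> by_cases hx2 : e ∈ ξ 2 <;> simp_all
  have e2 : triParam E s (ξ 1 ∩ freePair E s 0 1) (ξ 2 ∩ freePair E s 0 2) (ξ 2 ∩ freePair E s 1 2) 2 = ξ 2 := by
    ext e
    obtain ⟨hTe, h0e, h1e, h2e, hre, hc⟩ := key e
    simp only [triParam_two, frozenOpen, freePair, Set.mem_union, Set.mem_inter_iff, Set.mem_setOf_eq]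
    clear key hsub hξ hr hT
    by_cases he0 : e ∈ E 0 <;> by_cases he1 : e ∈ E 1 <;> by_cases he2 : e ∈ E 2 <;> by_cases hx0 : e ∈ ξ 0 <;>
      by_cases hx1 : e ∈ ξ 1 <;> by_cases hx2 : e ∈ ξ 2 <;> simp_all
  funext i
  fin_cases i
  · exact e0
  · exact e1
  · exact e2

/-- **Reparametrisation of fibre sums**: a sum over the fibre of `s` is an iterated sum over the subsets of the three free
blocks. [this work] -/
theorem sum_fibre_eq_sum_triParam [Fintype ι] (hs : s ∈ box (minDeg E)) (Φ : (Fin 3 → Set ι) → ℝ) :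
    ∑ ξ ∈ (truncSpace E).filter (fun ξ => redProfile E ξ = s), Φ ξ
      = ∑ x ∈ univ.filter (fun x : Set ι => x ⊆ freePair E s 0 1), ∑ y ∈ univ.filter (fun y : Set ι => y ⊆ freePair E s 0 2),
          ∑ z ∈ univ.filter (fun z : Set ι => z ⊆ freePair E s 1 2), Φ (triParam E s x y z) := by
  -- the iterated sum as a sum over the product of the three index sets
  have hprod : ∑ x ∈ univ.filter (fun x : Set ι => x ⊆ freePair E s 0 1), ∑ y ∈ univ.filter (fun y : Set ι => y ⊆ freePair E s 0 2),
        ∑ z ∈ univ.filter (fun z : Set ι => z ⊆ freePair E s 1 2), Φ (triParam E s x y z)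
      = ∑ p ∈ (univ.filter (fun x : Set ι => x ⊆ freePair E s 0 1)) ×ˢ
          ((univ.filter (fun y : Set ι => y ⊆ freePair E s 0 2)) ×ˢ (univ.filter (fun z : Set ι => z ⊆ freePair E s 1 2))),
          Φ (triParam E s p.1 p.2.1 p.2.2) := by
    rw [Finset.sum_product]
    refine sum_congr rfl fun x _ => ?_
    rw [Finset.sum_product]
  rw [hprod]
  symm
  refine Finset.sum_nbij' (fun p => triParam E s p.1 p.2.1 p.2.2)
    (fun ξ => (ξ 1 ∩ freePair E s 0 1, (ξ 2 ∩ freePair E s 0 2, ξ 2 ∩ freePair E s 1 2))) ?_ ?_ ?_ ?_ ?_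
  · rintro ⟨x, y, z⟩ hp
    simp only [mem_product, mem_filter, mem_univ, true_and] at hp
    rw [mem_filter]
    exact ⟨triParam_mem_truncSpace hT hp.1 hp.2.1 hp.2.2, redProfile_triParam hT hs hp.1 hp.2.1 hp.2.2⟩
  · intro ξ _
    simp only [mem_product, mem_filter, mem_univ, true_and]
    exact ⟨Set.inter_subset_right, Set.inter_subset_right, Set.inter_subset_right⟩
  · rintro ⟨x, y, z⟩ hp
    simp only [mem_product, mem_filter, mem_univ, true_and] at hp
    obtain ⟨h1, h2, h3⟩ := triParam_inter_freePair hp.1 hp.2.1 hp.2.2 hT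
    simp only [h1, h2, h3]
  · intro ξ hξ
    rw [mem_filter] at hξ
    exact eq_triParam_of_mem_fibre hT hξ.1 hξ.2
  · intro p _
    rfl

end Fibre

/-! ### The bridge -/

/-- **THE CLASS-T BRIDGE** (report §10.3): on the triangle class, for every profile `s` in the box of the minimal multidegree,
the (M⁺⁺-3) coefficient is the triangle functional of the sections,
`hybCoeff E U s = Σ_{x ⊆ freePair 0 1} Σ_{y ⊆ freePair 0 2} Σ_{z ⊆ freePair 1 2} h(y,z)·[2f(x,y)g(x,z) − f(x̄,ȳ)g(x,z) − f(x̄,y)g(x,z̄)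
− f(x,ȳ)g(x,z̄) + f(x̄,ȳ)g(x,z̄)] = TRI(f,g,h)`.  (Outside the box `hybCoeff = 0`, `hybCoeff_eq_zero_of_not_mem_box`.) [this work] -/
theorem hybCoeff_eq_tri [Fintype ι] {E : Fin 3 → Finset ι} (hT : IsClassT E) (U : Fin 3 → Set (Set ι))
    (hU : ∀ i, DeterminedBy (U i) ↑(E i)) {s : ι → ℕ} (hs : s ∈ box (minDeg E)) :
    hybCoeff E U s
      = ∑ x ∈ univ.filter (fun x : Set ι => x ⊆ freePair E s 0 1), ∑ y ∈ univ.filter (fun y : Set ι => y ⊆ freePair E s 0 2),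
          ∑ z ∈ univ.filter (fun z : Set ι => z ⊆ freePair E s 1 2), triTerm E s U x y z := by
  unfold hybCoeff
  rw [sum_fibre_eq_sum_triParam hT hs]
  refine sum_congr rfl fun x hx => sum_congr rfl fun y hy => sum_congr rfl fun z hz => ?_
  rw [mem_filter] at hx hy hz
  exact kernel_triParam hT hU hx.2 hy.2 hz.2

end SahiHybrid

end Summit.CriticalPhenomena.PercolationContinuityZ3.Theorems
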